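import Literature.InformationTheory.QuantumCodes.LocalCodeEnergyBarrierPeriodic
import Literature.InformationTheory.QuantumCodes.SubsystemCodeDistanceBoundPeriodic
import Literature.InformationTheory.QuantumCodes.SubsystemCodeEnergyBarrier
import HarnessLib

/-!
# Bravyi–Terhal 2009, Theorem 2* with periodic boundary conditions — proof

S. Bravyi, B. Terhal, arXiv:0810.1983 [BravyiTerhal2009], §1.2 Thm. 2* (chunk p0006 L60–63: «Under the assumptions
of Theorem 2 the energy barrier `d‡(𝒢)` is upper bounded by a constant independent of the lattice size `L` for any
choice of the gauge Pauli operators»), «Theorem 2 applies to both open and periodic boundary conditions» (p0006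
L41–42), and §3.3 Prop. 2 (p0013 L103–112: `d_1(𝒢) ≤ r` «with open or periodic boundary conditions … for any
L ≥ 2(r−1)²»); proof p0014 L17–27.

THIS FILE PROVES the torus case left as `TODO(general form)` in `SubsystemCodeEnergyBarrier.lean`:
`BravyiTerhal2009_theorem2_star_periodic` — on the `L × L` torus with `L ≥ 2(r−1)²`, for ANY gauge space `Ḡ` whose
stabilizer space `Ḡ ⊓ Ḡ⊥ = ⟨g_a⟩` is generated by operators in periodic `r × r` windows, at most `g_max` per qubit,
`k ≥ 1`: there is a dressed logical operator `E ∈ S̄⊥ ∖ Ḡ` and a single-qubit walk `0 → E` with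
`ε(P_i) ≤ 4 r² g_max` throughout (two fronts: the sweeping row and the seam).

Steps: `EnergyBarrier.exists_dressed_in_columns_periodic` (Prop. 2 on the torus: some `≤ r` columns support a dressed
logical operator — the contrapositive of `sympDual_gauge_le_of_slabs'` on the balanced slab index, constructed as in
`LocalCodeEnergyBarrierPeriodic.lean`), then the row-by-row walk and `energyCost_prefixWalk_le_periodic`.

## Mathlib / tree search

Tree: `sympDual_gauge_le_of_slabs'` (SubsystemCodeDistanceBoundPeriodic.lean); `exists_slabBoundaries`, `slabOf`,
`slabOf_mono`, `slabOf_le_succ`, `slabOf_wrap`, `card_filter_slabOf_le`, `periodic_window_cases`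
(LocalCodeDistanceBoundPeriodic.lean); `EnergyBarrier.{rowWalk, rowWalk_zero, rowWalk_last, isPauliWalk_rowWalk,
energyCost_prefixWalk_le_periodic}` (LocalCodeEnergyBarrier(Periodic).lean); `gaugeStabilizer`, `IsSubsystemCode`,
`finrank_sympDual_add` (SubsystemCodes.lean). (The specialisation `G = S̄` is `BravyiTerhal2009_theorem2_periodic` of
LocalCodeEnergyBarrierPeriodic.lean — not restated.)
-/

namespace Literature.InformationTheory.QuantumCodes

open Finset Module
open Classical

variable {n : ℕ}

namespace EnergyBarrier

variable {L : ℕ} {ι : Type*} {g : ι → SympVec n} {G : Submodule (ZMod 2) (SympVec n)}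

/-- **A set of `≤ r` columns of the torus supports a dressed logical operator** (Prop. 2 on the torus,
`L ≥ 2(r−1)²`; contrapositive of `sympDual_gauge_le_of_slabs'` for `k ≥ 1`, on the balanced slab index).
[cite: BravyiTerhal2009, §3.3 Prop. 2 (p. 13: «with open or periodic boundary conditions … d_1(𝒢) ≤ r for any L ≥ 2(r−1)²»)] -/
theorem exists_dressed_in_columns_periodic {D' k d r : ℕ} (e : Fin n ≃ (Fin (D' + 1) → Fin L)) (hr : 1 ≤ r)
    (hL : 2 * (r - 1) ^ 2 ≤ L) (hS : gaugeStabilizer G = Submodule.span (ZMod 2) (Set.range g))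
    (hg : ∀ a, IsCubeLocalPeriodic e r (g a)) (hcode : IsSubsystemCode G k d) (hk : 1 ≤ k) :
    ∃ C : Finset (Fin L), #C ≤ r ∧ ∃ Q ∈ sympDual (gaugeStabilizer G), Q ∉ G ∧
      Q ∈ supportedOn (univ.filter fun q => e q 0 ∈ C) := by
  -- a slab index β with parity separation, slabs inside ≤ r columns (as in the stabilizer case)
  obtain ⟨β, hsep, hcols⟩ : ∃ β : Fin n → ℕ,
      (∀ a, ∀ q ∈ sympSupport (g a), ∀ q' ∈ sympSupport (g a), β q % 2 = β q' % 2 → β q = β q') ∧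
      (∀ j, ∃ C : Finset (Fin L), #C ≤ r ∧ ∀ q, β q = j → e q 0 ∈ C) := by
    rcases Nat.lt_or_ge r 2 with hr1 | hr2
    · have hr1' : r = 1 := by omega
      subst hr1'
      refine ⟨fun q => ((e q) 0 : ℕ), ?_, ?_⟩
      · intro a q hq q' hq' _
        dsimp only
        obtain ⟨c, hc⟩ := hg a
        have h1 := periodic_window_cases (hc q hq 0)
        have h2 := periodic_window_cases (hc q' hq' 0)
        have := ((e q) 0).isLt
        have := ((e q') 0).isLt
        have := (c 0).isLt
        omega
      · intro j
        refine ⟨univ.filter fun t : Fin L => (t : ℕ) = j, ?_, fun q hq => by simpa using hq⟩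
        rw [Finset.card_le_one]
        intro a ha b hb
        simp only [mem_filter, mem_univ, true_and] at ha hb
        exact Fin.ext (by omega)
    · obtain ⟨K, t, ht, hKeven, hKpos⟩ :=
        exists_slabBoundaries (u := r - 1) (L := L) (by omega)
          (by have : 2 * (r - 1) * (r - 1) = 2 * (r - 1) ^ 2 := by ring
              omega)
      refine ⟨fun q => slabOf ht hKpos ((e q) 0 : ℕ), ?_, ?_⟩
      · intro a q hq q' hq' hpar
        dsimp only at hpar ⊢
        obtain ⟨c, hc⟩ := hg a
        have h1 := periodic_window_cases (hc q hq 0)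
        have h2 := periodic_window_cases (hc q' hq' 0)
        have hx := ((e q) 0).isLt
        have hx' := ((e q') 0).isLt
        have hc₀L := (c 0).isLt
        set x : ℕ := ((e q) 0 : ℕ) with hxdef
        set x' : ℕ := ((e q') 0 : ℕ) with hx'def
        set c₀ : ℕ := ((c 0 : Fin L) : ℕ) with hc₀
        have nowrap : ∀ {y y' : ℕ}, y ≤ y' → y' ≤ y + (r - 1) → y' < L →
            slabOf ht hKpos y % 2 = slabOf ht hKpos y' % 2 → slabOf ht hKpos y = slabOf ht hKpos y' := by
          intro y y' hyy' hy'u hy'L hp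
          have a1 := slabOf_mono ht hKpos hyy' hy'L
          have a2 := slabOf_le_succ ht hKpos hyy' hy'u hy'L
          omega
        have wrap : ∀ {y y' : ℕ}, y < L → y' < L → y' + L ≤ y + (r - 1) →
            slabOf ht hKpos y % 2 ≠ slabOf ht hKpos y' % 2 := by
          intro y y' hyL hy'L hw
          obtain ⟨b1, b2⟩ := slabOf_wrap ht hKpos hyL hy'L hw
          rw [b1, b2]
          omega
        rcases h1 with ⟨h1a, h1b⟩ | ⟨h1a, h1b⟩ <;> rcases h2 with ⟨h2a, h2b⟩ | ⟨h2a, h2b⟩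
        · rcases le_total x x' with hle | hle
          · exact nowrap hle (by omega) hx' hpar
          · exact (nowrap hle (by omega) hx hpar.symm).symm
        · exact absurd hpar (wrap hx hx' (by omega))
        · exact absurd hpar.symm (wrap hx' hx (by omega))
        · rcases le_total x x' with hle | hle
          · exact nowrap hle (by omega) hx' hpar
          · exact (nowrap hle (by omega) hx hpar.symm).symm
      · intro j
        refine ⟨univ.filter fun c : Fin L => slabOf ht hKpos c = j,
          (card_filter_slabOf_le ht hKpos j).trans (by omega), fun q hq => by simpa using hq⟩
  -- no slab supports a dressed logical ⇒ Ḡ⊥ ≤ Ḡ ⇒ k = 0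
  by_contra hnone
  push Not at hnone
  have h0 : ∀ j, ∀ Q ∈ sympDual (gaugeStabilizer G), Q ∈ supportedOn (slab β j) → Q ∈ G := by
    intro j Q hQd hQs
    obtain ⟨C, hC, hCq⟩ := hcols j
    by_contra hQG
    refine hnone C hC Q hQd hQG fun i hi => hQs i fun hij => hi ?_
    rw [mem_slab] at hij
    exact mem_filter.2 ⟨mem_univ _, hCq i hij⟩
  have hle : sympDual G ≤ G := sympDual_gauge_le_of_slabs' β g hS hsep h0
  have hSe : gaugeStabilizer G = sympDual G := inf_eq_right.2 hle
  have hdim := hcode.1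
  rw [hSe] at hdim
  omega

end EnergyBarrier

open EnergyBarrier in
/-- **Bravyi–Terhal 2009, Theorem 2* on the torus — proved** (explicit constant; range `L ≥ 2(r−1)²` of the torus
Prop. 2). For the stabilizer Hamiltonian `H = −Σ_a g_a` on the `L × L` torus, every generator in an `r × r` window
modulo `L` (`r ≥ 1`), every qubit in at most `g_max` generators, and ANY gauge space `Ḡ` whose stabilizer space
`Ḡ ⊓ Ḡ⊥` is `⟨g_a⟩`, with `k ≥ 1`: there is a dressed logical operator `E ∈ S̄⊥ ∖ Ḡ` and a walk
`0 = P_0, …, P_{L²} = E` on the Pauli group (consecutive classes differ on at most one qubit) with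
`ε(P_i) ≤ 4 r² g_max` for every `i`; so `d‡(𝒢) ≤ 4 r² g_max`, independent of `L`. Column: proved theorem.
[cite: BravyiTerhal2009, §1.2 Thm. 2* (p. 6) with «Theorem 2 applies to both open and periodic boundary conditions» (p. 6), Prop. 2 (p. 13) and the proof on p. 14] -/
theorem BravyiTerhal2009_theorem2_star_periodic {L n k d : ℕ} (r gmax : ℕ) (e : Fin n ≃ (Fin 2 → Fin L))
    {ι : Type*} [Fintype ι] (g : ι → SympVec n) (G : Submodule (ZMod 2) (SympVec n)) (hr : 1 ≤ r)
    (hL : 2 * (r - 1) ^ 2 ≤ L) (hS : gaugeStabilizer G = Submodule.span (ZMod 2) (Set.range g))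
    (hg : ∀ a, IsCubeLocalPeriodic e r (g a))
    (hdeg : ∀ q : Fin n, #(univ.filter fun a => q ∈ sympSupport (g a)) ≤ gmax) (hcode : IsSubsystemCode G k d)
    (hk : 1 ≤ k) :
    ∃ E ∈ sympDual (gaugeStabilizer G), E ∉ G ∧ ∃ (m : ℕ) (γ : Fin (m + 1) → SympVec n),
      γ 0 = 0 ∧ γ (Fin.last m) = E ∧ IsPauliWalk γ ∧ ∀ i, energyCost g (γ i) ≤ 4 * r ^ 2 * gmax := by
  have hn : n = L ^ 2 := by simpa using Fintype.card_congr e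
  have hLpos : 0 < L := by
    rcases Nat.eq_zero_or_pos L with h | h
    · exfalso
      rw [h] at hn
      simp at hn
      subst hn
      have h1 := hcode.1
      have h2 := finrank_sympDual_add G
      omega
    · exact h
  obtain ⟨C, hC, Q, hQd, hQG, hQs⟩ := exists_dressed_in_columns_periodic (D' := 1) e hr hL hS hg hcode hk
  have hE : ∀ a, sympInner (g a) Q = 0 := fun a =>
    (mem_sympDual_iff.1 hQd) (g a) (by rw [hS]; exact Submodule.subset_span ⟨a, rfl⟩)
  refine ⟨Q, hQd, hQG, L * L, rowWalk e Q, rowWalk_zero Q, rowWalk_last Q, isPauliWalk_rowWalk hLpos Q,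
    fun i => ?_⟩
  calc energyCost g (rowWalk e Q i) ≤ 2 * (#C * (r + r)) * gmax :=
        energyCost_prefixWalk_le_periodic hLpos hr hg hdeg hE hQs i
    _ ≤ 2 * (r * (r + r)) * gmax := by gcongr
    _ = 4 * r ^ 2 * gmax := by ring

end Literature.InformationTheory.QuantumCodes
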